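import Literature.AlgebraicGeometry.ShimuraVarieties.UnitaryAuxiliaryReflexInduced
import Mathlib.RingTheory.MvPolynomial.Symmetric.NewtonIdentities
import Mathlib.RingTheory.Norm.Transitivity
import HarnessLib

/-!
# The reflex composita of the `τ`-adapted CM types never meet inside `τ(L)` when `[L⁺:ℚ]` is odd and no adapted type has
# small reflex — the obstruction to closing hDel's residual by Deligne 1971 Prop. 5.10

Summits side, binder subdirectory `CorCM/HypDel/` (cell `hodgecm-mathlib`, seat B-typ04 g2; director g2 ruling 2026-08-28T04:47:38Z (b)).
THEOREMS ONLY (no definition, no named fact, no `sorry`; nothing is discharged).  Companion of `BaseDescentOfDescentToIntersection`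
(p605793): there, row I-6 (`UnitaryCanonicalModel.descentToIntersection_printed` = [Deligne1971TravauxShimura] Prop. 5.10 read at the unitary
tower) closes the residual `NoSmallReflexBaseDescent` of the `HDel` workfile `Lines/B1HeckeQuotientDescent.lean` (v10b :1300/:1349) UNDER the
census inclusion `E∩ := ⨅_{Φ ∋ τ} E♯(Φ) ⊆ τ(L)` (`E♯(Φ) = Aux.reflexField L Φ τ = τ(L)·E*(Φ)`, `Φ` running over the `τ`-adapted CM types,
`Aux.IsAdapted L Φ τ := τ ∈ Φ`).  The workfile's stub docstring asks the CENSUS question («for such `L`, is `⋂_{Φ ∋ τ} E*(Φ)·τ(L) = τ(L)`?»).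
This file answers it in the negative for odd `d = [L⁺:ℚ]` — in particular for every sextic `L`, the summit's case — with a PROOF:

* §1 `prod_cmType_mem_traceField` — the type norm `N_Φ(x) = ∏_{φ ∈ Φ} φ(x)` lies in the reflex field `E*(Φ) = traceField Φ` (Newton's
  identities over the power sums `tr_Φ(x^j)`, Mathlib `MvPolynomial.mul_esymm_eq_sum`);
* §2 `algebraMap_norm_eq_prod_mul_conj` — `N_{L/ℚ}(x) = ∏_{φ ∈ Φ} φ(x)·conj φ(x)` (so `N(x) > 0`, `norm_pos_of_cmType`), and for `x̄ = -x`: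
  `(∏_{φ∈Φ} φ(x))² = (-1)^{|Φ|} N(x)` (`prod_cmType_sq_eq`); §3 `card_toFinset_cmType` — `|Φ| = #places = d`;
* §4 `prod_erase_mem_reflexField`, `prod_erase_mul_sq_eq`, **`prod_erase_mem_iInf_reflexField`** — the off-`τ` type norm
  `u_Φ(x) = ∏_{φ ∈ Φ, φ ≠ τ} φ(x) = N_Φ(x)/τ(x)` lies in `E♯(Φ)`, `(u_Φ(x)·τ(x))² = (-1)^d N(x)` does not depend on `Φ`, hence
  `u_{Φ₀}(x) = ± u_Φ(x)` lies in EVERY `E♯(Φ)`: `u_{Φ₀}(x) ∈ E∩`;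
* §5 a square root of a negative rational generates an imaginary quadratic subfield (`finrank_adjoin_eq_two_of_sq_eq_neg`,
  `isTotallyComplex_adjoin_of_sq_eq_neg`);
* §6 **`exists_isAdapted_and_hasSmallReflex_of_iInf_reflexField_le_range_of_odd`** — `d` odd and `E∩ ⊆ τ(L)` ⟹ `u = τ(w)`,
  `(wx)² = -N(x)`, `ℚ(wx) ⊆ L` imaginary quadratic ⟹ an adapted CM type WITH small reflex (tree
  `Aux.exists_isAdapted_and_hasSmallReflex_of_quadraticSubfield`); contrapositive
  **`not_iInf_reflexField_le_range_of_odd_of_forall_not_hasSmallReflex`**: under the stub's hypothesis «no adapted `Φ` has small reflex»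
  and `d` odd, `E∩ ⊄ τ(L)` — Prop. 5.10 over the adapted types descends hDel's tower only to a PROPER extension of `τ(L)`
  ([Liu2021] Rem. C.15: «it is possible that `⋂_Φ E♯_{V,Φ}` strictly contains `τ'(E)`»; here: it always does, for odd `d` in that class).

CONSEQUENCE FOR THE LINE (director g2 04:47:38Z (c), booked): «I-6 + census» is VACUOUS against «no small reflex» for odd `d`; the odd-`d`
residual of hDel is the descent `E∩ → τ(L)` ([Deligne1979ShimuraVarieties] §2.7, abelian type), candidate row I-7, not Deligne 1971 Prop. 5.10.
Galois bookkeeping (NOT formalised here, for the planner's numbers): writing `Λ = Gal(L^c/τL)` acting on the `d-1` conjugate pairs off `τ`,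
«no adapted small reflex» ⟺ `Λ` lies in no type-stabiliser, and `E∩ = τ(L)` ⟺ `Λ` is generated by type-stabilising elements; for sextic `L`
the former happens exactly for `Gal(L^c/ℚ) ≅ C₂ × A₄` (order 24, `E∩ = L^c`, degree 4 over `τL`) and `C₂ × S₄` (order 48,
`E∩ = τL(√-N(x))`, degree 2 over `τL`); for even `d` both can hold together (e.g. an octic `L` over a `D₄`-quartic `L⁺` with
`|Gal(L^c/ℚ)| = 32`), where p605793 does close the residual.  HC_CM is proved only modulo the 7 printed citations until rung 0 closes; this
file discharges no binder.

## References
* [Deligne1971TravauxShimura] P. Deligne, *Travaux de Shimura*, Sém. Bourbaki 389, LNM 244 (1971), Prop. 5.10 p. 157.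
* [Deligne1979ShimuraVarieties] P. Deligne, *Variétés de Shimura*, PSPUM 33.2 (1979), §2.7.
* [Liu2021] Y. Liu, App. C Lem. C.14, Rem. C.15 (p. 113).
* [Shimura1998] G. Shimura, *Abelian Varieties with Complex Multiplication and Modular Functions*, §8.3 Prop. 28, §8.4 Example (1), §18.2.
* [MilneCM2006] J. S. Milne, *Complex Multiplication* (2006), Ch. I §1 Def. 1.8, Prop. 1.18 (c) (the reflex norm).
-/

set_option autoImplicit false

noncomputable section

open NumberField Module Finset
open scoped ComplexConjugate IntermediateField
open Literature.AlgebraicGeometry.Motives (CMType)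
open Literature.NumberTheory.ComplexMultiplication (cmTypeTrace traceField cmTypeTrace_mem_traceField)
open Literature.AlgebraicGeometry.ShimuraVarieties
open Literature.AlgebraicGeometry.ShimuraVarieties.UnitaryCanonicalModel

namespace Summit.HodgeConjecture.CorCM.HypDel

variable {L : Type} [Field L] [NumberField L]

/-! ### §1. The type norm lies in the reflex field (Newton's identities) -/

/-- Power sums of the `Φ`-conjugates of `x` are type traces: `∑_{φ ∈ Φ} φ(x)^j = tr_Φ(x^j) ∈ E*(Φ)`.
[cite: Shimura1998, §8.3 Prop. 28] -/
theorem sum_pow_mem_traceField (Φ : CMType L) (x : L) (j : ℕ) :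
    (∑ φ ∈ (Set.toFinite Φ.1).toFinset, φ x ^ j) ∈ traceField Φ := by
  have h : (∑ φ ∈ (Set.toFinite Φ.1).toFinset, φ x ^ j) = cmTypeTrace Φ (x ^ j) := by
    rw [Literature.NumberTheory.ComplexMultiplication.cmTypeTrace_apply]
    exact Finset.sum_congr rfl fun φ _ => (map_pow φ x j).symm
  rw [h]
  exact cmTypeTrace_mem_traceField Φ (x ^ j)

/-- Every elementary symmetric function of the `Φ`-conjugates `(φ(x))_{φ ∈ Φ}` lies in the reflex field `E*(Φ) = ℚ(tr_Φ(L))`: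
Newton's identities `k·e_k = ∑_{i=1}^{k} (-1)^{i-1} e_{k-i} p_i` express `e_k` rationally in the power sums `p_i = tr_Φ(x^i)`.
[cite: Shimura1998, §8.3 Prop. 28] [cite: MilneCM2006, Ch. I §1 (the reflex norm)] -/
theorem esymm_mem_traceField (Φ : CMType L) (x : L) (k : ℕ) :
    ((univ.val.map fun φ : ↥(Set.toFinite Φ.1).toFinset => (φ.1 : L →+* ℂ) x).esymm k : ℂ) ∈ traceField Φ := by
  classical
  set S := (Set.toFinite Φ.1).toFinset with hS
  set f : ↥S → ℂ := fun φ => (φ.1 : L →+* ℂ) x with hf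
  -- power sums are type traces
  have hp : ∀ j : ℕ, MvPolynomial.aeval f (MvPolynomial.psum ↥S ℚ j) ∈ traceField Φ := by
    intro j
    have : MvPolynomial.aeval f (MvPolynomial.psum ↥S ℚ j) = ∑ φ ∈ S, φ x ^ j := by
      simp only [MvPolynomial.psum, map_sum, map_pow, MvPolynomial.aeval_X, hf]
      exact Finset.sum_coe_sort S (fun φ : L →+* ℂ => φ x ^ j)
    rw [this]
    exact sum_pow_mem_traceField Φ x j
  -- strong induction on `k` via Newton's identities
  induction k using Nat.strong_induction_on with
  | _ k ih =>
    have he : ∀ i, MvPolynomial.aeval f (MvPolynomial.esymm ↥S ℚ i) = (univ.val.map f).esymm i := fun i =>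
      MvPolynomial.aeval_esymm_eq_multiset_esymm ↥S ℚ i f
    rcases Nat.eq_zero_or_pos k with rfl | hk
    · rw [← he 0, MvPolynomial.esymm_zero, map_one]
      exact one_mem _
    · have hN := congrArg (MvPolynomial.aeval f) (MvPolynomial.mul_esymm_eq_sum ↥S ℚ k)
      simp only [map_mul, map_natCast, map_pow, map_neg, map_one, map_sum, he] at hN
      -- the right-hand side lies in `E*(Φ)`
      have hR : ((-1 : ℂ) ^ (k + 1) * ∑ a ∈ (antidiagonal k).filter (fun a => a.1 < k),
          (-1) ^ a.1 * (univ.val.map f).esymm a.1 * MvPolynomial.aeval f (MvPolynomial.psum ↥S ℚ a.2)) ∈ traceField Φ := by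
        refine mul_mem (pow_mem (neg_mem (one_mem _)) _) (sum_mem fun a ha => ?_)
        have ha' : a.1 < k := (Finset.mem_filter.1 ha).2
        exact mul_mem (mul_mem (pow_mem (neg_mem (one_mem _)) _) (ih a.1 ha')) (hp a.2)
      rw [← hN] at hR
      have hk0 : (k : ℂ) ≠ 0 := Nat.cast_ne_zero.2 hk.ne'
      have : (univ.val.map f).esymm k = (k : ℂ)⁻¹ * ((k : ℂ) * (univ.val.map f).esymm k) := by
        rw [← mul_assoc, inv_mul_cancel₀ hk0, one_mul]
      rw [this]
      exact mul_mem (inv_mem (natCast_mem _ k)) hR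

/-- **The type norm `N_Φ(x) = ∏_{φ ∈ Φ} φ(x)` lies in the reflex field `E*(Φ)`** (the top elementary symmetric function).
[cite: Shimura1998, §8.3 Prop. 28] [cite: MilneCM2006, Ch. I §1 (the reflex norm)] -/
theorem prod_cmType_mem_traceField (Φ : CMType L) (x : L) :
    (∏ φ ∈ (Set.toFinite Φ.1).toFinset, φ x) ∈ traceField Φ := by
  classical
  set S := (Set.toFinite Φ.1).toFinset with hS
  set f : ↥S → ℂ := fun φ => (φ.1 : L →+* ℂ) x with hf
  have h := esymm_mem_traceField Φ x (univ.val.map f).card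
  have h1 : (univ.val.map f).esymm (univ.val.map f).card = (univ.val.map f).prod := by
    rw [Multiset.esymm, Multiset.powersetCard_self, Multiset.map_singleton, Multiset.sum_singleton]
  have h2 : (univ.val.map f).prod = ∏ φ ∈ S, φ x := by
    rw [← Finset.prod_eq_multiset_prod]
    exact Finset.prod_coe_sort S (fun φ : L →+* ℂ => φ x)
  rw [h1, h2] at h
  exact h

/-! ### §2. `N_{L/ℚ}(x) = ∏_{φ ∈ Φ} φ(x)·\overline{φ(x)}` for a CM type `Φ`; positivity; the square of the type norm -/

/-- **The norm through a CM type**: `N_{L/ℚ}(x) = ∏_{φ ∈ Φ} φ(x)·conj(φ(x))` — the complex embeddings are `Φ ⊔ Φ̄`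
(Mathlib `Algebra.norm_eq_prod_embeddings`, and `φ ↦ φ̄` is a bijection `Φ → Φᶜ` by the CM-type axiom `φ ∈ Φ ↔ φ̄ ∉ Φ`).
[cite: Shimura1998, §8.3 Prop. 28] [cite: MilneCM2006, Ch. I §1 Def. 1.8] -/
theorem algebraMap_norm_eq_prod_mul_conj (Φ : CMType L) (x : L) :
    algebraMap ℚ ℂ (Algebra.norm ℚ x) = ∏ φ ∈ (Set.toFinite Φ.1).toFinset, (φ x * conj (φ x)) := by
  classical
  set S := (Set.toFinite Φ.1).toFinset with hS
  have hmem : ∀ φ : L →+* ℂ, φ ∈ S ↔ φ ∈ Φ.1 := fun φ => Set.Finite.mem_toFinset _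
  have hN : algebraMap ℚ ℂ (Algebra.norm ℚ x) = ∏ φ : L →+* ℂ, φ x := by
    rw [Algebra.norm_eq_prod_embeddings ℚ ℂ x]
    exact Fintype.prod_equiv RingHom.equivRatAlgHom.symm _ _ (fun σ => rfl)
  rw [hN, ← Finset.prod_mul_prod_compl S, Finset.prod_mul_distrib]
  congr 1
  refine Finset.prod_nbij' (fun φ => ComplexEmbedding.conjugate φ) (fun φ => ComplexEmbedding.conjugate φ)
    (fun φ hφ => ?_) (fun φ hφ => ?_) (fun φ _ => ComplexEmbedding.involutive_conjugate L φ)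
    (fun φ _ => ComplexEmbedding.involutive_conjugate L φ) (fun φ _ => ?_)
  · -- `φ ∉ Φ ⇒ φ̄ ∈ Φ`
    rw [Finset.mem_compl, hmem] at hφ
    rw [hmem]
    by_contra h
    exact hφ ((Φ.2 φ).2 h)
  · -- `φ ∈ Φ ⇒ φ̄ ∉ Φ`
    rw [hmem] at hφ
    rw [Finset.mem_compl, hmem]
    exact (Φ.2 φ).1 hφ
  · rw [ComplexEmbedding.conjugate_coe_eq, Complex.conj_conj]

/-- **The norm of a non-zero element of a field with a CM type is a positive rational** (`N(x) = ∏_{φ ∈ Φ} |φ(x)|² > 0`).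
[cite: Shimura1998, §8.3 Prop. 28] -/
theorem norm_pos_of_cmType (Φ : CMType L) {x : L} (hx : x ≠ 0) : 0 < Algebra.norm ℚ x := by
  classical
  have h := algebraMap_norm_eq_prod_mul_conj Φ x
  have h' : (algebraMap ℚ ℂ (Algebra.norm ℚ x)) =
      ((∏ φ ∈ (Set.toFinite Φ.1).toFinset, Complex.normSq (φ x) : ℝ) : ℂ) := by
    rw [h, Complex.ofReal_prod]
    exact Finset.prod_congr rfl fun φ _ => Complex.mul_conj (φ x)
  have hpos : 0 < ∏ φ ∈ (Set.toFinite Φ.1).toFinset, Complex.normSq (φ x) :=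
    Finset.prod_pos fun φ _ => Complex.normSq_pos.2 ((map_ne_zero φ).2 hx)
  have hq : ((Algebra.norm ℚ x : ℚ) : ℂ) = ((∏ φ ∈ (Set.toFinite Φ.1).toFinset, Complex.normSq (φ x) : ℝ) : ℂ) := by
    rw [← h']; exact (eq_ratCast (algebraMap ℚ ℂ) _).symm
  have hr : ((Algebra.norm ℚ x : ℚ) : ℝ) = ∏ φ ∈ (Set.toFinite Φ.1).toFinset, Complex.normSq (φ x) := by
    exact_mod_cast (by rw [← Complex.ofReal_ratCast] at hq; exact Complex.ofReal_injective hq)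
  exact_mod_cast (hr ▸ hpos : (0 : ℝ) < ((Algebra.norm ℚ x : ℚ) : ℝ))

/-- **Square of the type norm of a purely imaginary element**: if `conj(φ(x)) = -φ(x)` for every embedding (i.e. `x̄ = -x`), then
`(∏_{φ ∈ Φ} φ(x))² = (-1)^{|Φ|} · N_{L/ℚ}(x)`. [cite: Shimura1998, §8.3 Prop. 28] -/
theorem prod_cmType_sq_eq (Φ : CMType L) (x : L) (hx : ∀ φ : L →+* ℂ, conj (φ x) = -φ x) :
    (∏ φ ∈ (Set.toFinite Φ.1).toFinset, φ x) ^ 2 =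
      (-1) ^ (Set.toFinite Φ.1).toFinset.card * algebraMap ℚ ℂ (Algebra.norm ℚ x) := by
  classical
  set S := (Set.toFinite Φ.1).toFinset with hS
  rw [algebraMap_norm_eq_prod_mul_conj Φ x, ← Finset.prod_pow]
  have h1 : ∏ φ ∈ S, φ x * conj (φ x) = ∏ φ ∈ S, -(φ x ^ 2) :=
    Finset.prod_congr rfl fun φ _ => by rw [hx φ, mul_neg, sq]
  rw [h1, Finset.prod_neg, ← mul_assoc, ← pow_add, ← two_mul, pow_mul, neg_one_sq, one_pow, one_mul]

/-! ### §3. A CM type has one embedding per infinite place: `|Φ| = #(infinite places)` -/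

/-- **`|Φ|` is the number of infinite places** (`φ ↦` its place is a bijection `Φ → {places}`: injective because `Φ` never contains a
conjugate pair, surjective because it contains one of `φ_w, φ̄_w` for every `w`). [cite: MilneCM2006, Ch. I §1 Def. 1.8] -/
theorem card_toFinset_cmType (Φ : CMType L) :
    (Set.toFinite Φ.1).toFinset.card = Fintype.card (InfinitePlace L) := by
  classical
  set S := (Set.toFinite Φ.1).toFinset with hS
  have hmem : ∀ φ : L →+* ℂ, φ ∈ S ↔ φ ∈ Φ.1 := fun φ => Set.Finite.mem_toFinset _
  rw [← Finset.card_univ]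
  refine Finset.card_bij (fun φ _ => InfinitePlace.mk φ) (fun φ _ => Finset.mem_univ _) (fun φ hφ ψ hψ h => ?_)
    (fun w _ => ?_)
  · rcases InfinitePlace.mk_eq_iff.1 h with h | h
    · exact h
    · exact absurd ((hmem _).1 (h ▸ hψ)) ((Φ.2 φ).1 ((hmem φ).1 hφ))
  · by_cases hw : InfinitePlace.embedding w ∈ Φ.1
    · exact ⟨_, (hmem _).2 hw, InfinitePlace.mk_embedding w⟩
    · refine ⟨ComplexEmbedding.conjugate (InfinitePlace.embedding w), (hmem _).2 ?_, ?_⟩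
      · by_contra h
        exact hw ((Φ.2 _).2 h)
      · rw [InfinitePlace.mk_conjugate_eq, InfinitePlace.mk_embedding]

/-! ### §4. The off-`τ` type norm `u_Φ(x) = ∏_{φ ∈ Φ, φ ≠ τ} φ(x)` lies in the reflex compositum `E♯(Φ) = τ(L)·E*(Φ)` -/

section CM

variable [IsCMField L]

omit [IsCMField L] in
/-- **`u_Φ(x) = ∏_{φ ∈ Φ, φ ≠ τ} φ(x) ∈ E♯(Φ) = τ(L)·E*(Φ)`**: `u_Φ(x)·τ(x) = N_Φ(x) ∈ E*(Φ)` (`prod_cmType_mem_traceField`) and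
`τ(x) ∈ τ(L)`. [cite: Liu2021, App. C Lem. C.14 (p. 113)] [cite: Shimura1998, §8.3 Prop. 28] -/
theorem prod_erase_mem_reflexField [DecidableEq (L →+* ℂ)] (Φ : CMType L) (τ : L →+* ℂ) (x : L) :
    (∏ φ ∈ ((Set.toFinite Φ.1).toFinset.erase τ), φ x) ∈ Aux.reflexField L Φ τ := by
  classical
  set S := (Set.toFinite Φ.1).toFinset with hS
  have hE : traceField Φ ≤ Aux.reflexField L Φ τ := le_sup_right
  by_cases hτ : τ ∈ S
  · by_cases hx : x = 0
    · subst hx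
      simp only [map_zero, Finset.prod_const]
      exact pow_mem (zero_mem _) _
    · have hmul : (∏ φ ∈ S.erase τ, φ x) * τ x = ∏ φ ∈ S, φ x := Finset.prod_erase_mul S (fun φ => φ x) hτ
      have hτx : τ x ≠ 0 := (map_ne_zero τ).2 hx
      have : (∏ φ ∈ S.erase τ, φ x) = (∏ φ ∈ S, φ x) * (τ x)⁻¹ := by
        rw [← hmul, mul_inv_cancel_right₀ hτx]
      rw [this]
      exact mul_mem (hE (prod_cmType_mem_traceField Φ x)) (inv_mem (Aux.apply_mem_reflexField L Φ τ x))
  · rw [Finset.erase_eq_of_notMem hτ]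
    exact hE (prod_cmType_mem_traceField Φ x)

/-- For `x̄ = -x` in a CM field, `conj(φ(x)) = -φ(x)` under every complex embedding. [cite: Shimura1998, §18.2] -/
theorem conj_apply_eq_neg {x : L} (hx : IsCMField.complexConj L x = -x) (φ : L →+* ℂ) : conj (φ x) = -φ x := by
  rw [← IsCMField.complexEmbedding_complexConj L φ x, hx, map_neg]

/-- **Square of the off-`τ` type norm**: for `τ ∈ Φ` and `x̄ = -x`,
`(u_Φ(x)·τ(x))² = (-1)^d · N_{L/ℚ}(x)`, `d` = the number of infinite places of `L` (= `[L⁺:ℚ]`) — independent of `Φ`.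
[cite: Shimura1998, §8.3 Prop. 28] -/
theorem prod_erase_mul_sq_eq [DecidableEq (L →+* ℂ)] (Φ : CMType L) {τ : L →+* ℂ} (hτ : Aux.IsAdapted L Φ τ) {x : L}
    (hx : IsCMField.complexConj L x = -x) :
    ((∏ φ ∈ ((Set.toFinite Φ.1).toFinset.erase τ), φ x) * τ x) ^ 2 =
      (-1) ^ Fintype.card (InfinitePlace L) * algebraMap ℚ ℂ (Algebra.norm ℚ x) := by
  classical
  have hτS : τ ∈ (Set.toFinite Φ.1).toFinset := (Set.Finite.mem_toFinset _).2 hτ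
  rw [Finset.prod_erase_mul _ (fun φ => φ x) hτS, prod_cmType_sq_eq Φ x (conj_apply_eq_neg hx), card_toFinset_cmType Φ]

/-- **`u_{Φ₀}(x)` lies in EVERY reflex compositum `E♯(Φ)`, `Φ ∋ τ`** (for `x̄ = -x`): `u_Φ(x) ∈ E♯(Φ)` and `u_Φ(x)² = u_{Φ₀}(x)²`
(`prod_erase_mul_sq_eq`), so `u_{Φ₀}(x) = ± u_Φ(x)`.  Hence `u_{Φ₀}(x) ∈ E∩ = ⨅_{Φ ∋ τ} E♯(Φ)`.
[cite: Liu2021, App. C Rem. C.15 (p. 113)] [cite: Shimura1998, §8.3 Prop. 28] -/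
theorem prod_erase_mem_iInf_reflexField [DecidableEq (L →+* ℂ)] (τ : L →+* ℂ) {Φ₀ : CMType L} (h₀ : Aux.IsAdapted L Φ₀ τ) {x : L}
    (hx : IsCMField.complexConj L x = -x) :
    (∏ φ ∈ ((Set.toFinite Φ₀.1).toFinset.erase τ), φ x) ∈
      (⨅ Φ : {Φ : CMType L // Aux.IsAdapted L Φ τ}, Aux.reflexField L Φ.1 τ : IntermediateField ℚ ℂ) := by
  classical
  rw [← SetLike.mem_coe, IntermediateField.coe_iInf, Set.mem_iInter]
  rintro ⟨Φ, hΦ⟩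
  rw [SetLike.mem_coe]
  by_cases hx0 : x = 0
  · subst hx0
    simp only [map_zero, Finset.prod_const]
    exact pow_mem (zero_mem _) _
  have hΦmem := prod_erase_mem_reflexField Φ τ x
  have hsq : (∏ φ ∈ ((Set.toFinite Φ₀.1).toFinset.erase τ), φ x) ^ 2 = (∏ φ ∈ ((Set.toFinite Φ.1).toFinset.erase τ), φ x) ^ 2 := by
    have h1 := prod_erase_mul_sq_eq Φ₀ h₀ hx
    have h2 := prod_erase_mul_sq_eq Φ hΦ hx
    rw [mul_pow] at h1 h2
    exact mul_right_cancel₀ (pow_ne_zero 2 ((map_ne_zero τ).2 hx0)) (h1.trans h2.symm)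
  rcases sq_eq_sq_iff_eq_or_eq_neg.1 hsq with h | h
  · rw [h]; exact hΦmem
  · rw [h]; exact neg_mem hΦmem

/-! ### §5. A square root of a negative rational generates an imaginary quadratic subfield -/

omit [IsCMField L] in
/-- `ℚ(z)` has degree `2` when `z² = -q`, `q ∈ ℚ_{>0}` (`z ∉ ℚ` since squares of rationals are `≥ 0`). [cite: Shimura1998, §8.4 Example (1)] -/
theorem finrank_adjoin_eq_two_of_sq_eq_neg {z : L} {q : ℚ} (hq : 0 < q) (hz : z ^ 2 = -((q : ℚ) : L)) :
    finrank ℚ ℚ⟮z⟯ = 2 := by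
  have hint : IsIntegral ℚ z := Algebra.IsIntegral.isIntegral z
  have hle : finrank ℚ ℚ⟮z⟯ ≤ 2 := by
    rw [IntermediateField.adjoin.finrank hint]
    have hp0 : (Polynomial.X ^ 2 + Polynomial.C q : Polynomial ℚ) ≠ 0 :=
      Polynomial.X_pow_add_C_ne_zero (by norm_num) q
    have hpz : Polynomial.aeval z (Polynomial.X ^ 2 + Polynomial.C q : Polynomial ℚ) = 0 := by
      simp only [map_add, map_pow, Polynomial.aeval_X, Polynomial.aeval_C, hz]
      rw [eq_ratCast]; ring
    have h := Polynomial.natDegree_le_natDegree (minpoly.degree_le_of_ne_zero ℚ z hp0 hpz)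
    rwa [Polynomial.natDegree_X_pow_add_C] at h
  have hne1 : finrank ℚ ℚ⟮z⟯ ≠ 1 := by
    intro h1
    have hbot : ℚ⟮z⟯ = ⊥ := IntermediateField.finrank_eq_one_iff.1 h1
    have hzmem : z ∈ (⊥ : IntermediateField ℚ L) := hbot ▸ IntermediateField.mem_adjoin_simple_self ℚ z
    obtain ⟨r, hr⟩ := IntermediateField.mem_bot.1 hzmem
    have h2 : ((r ^ 2 : ℚ) : L) = ((-q : ℚ) : L) := by
      push_cast
      rw [← hz, ← hr]
      exact (eq_ratCast (algebraMap ℚ L) r) ▸ rfl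
    have h3 : r ^ 2 = -q := Rat.cast_injective h2
    nlinarith [sq_nonneg r]
  have hpos : 0 < finrank ℚ ℚ⟮z⟯ := finrank_pos
  omega

omit [IsCMField L] in
/-- `ℚ(z)` is totally complex when `z² = -q`, `q ∈ ℚ_{>0}`: under a real embedding `z` would be a real number of negative square.
[cite: Shimura1998, §8.4 Example (1)] -/
theorem isTotallyComplex_adjoin_of_sq_eq_neg {z : L} {q : ℚ} (hq : 0 < q) (hz : z ^ 2 = -((q : ℚ) : L)) :
    IsTotallyComplex ℚ⟮z⟯ := by
  refine ⟨fun w => InfinitePlace.isComplex_iff.2 fun hreal => ?_⟩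
  set φ := InfinitePlace.embedding w with hφ
  let z₀ : ℚ⟮z⟯ := ⟨z, IntermediateField.mem_adjoin_simple_self ℚ z⟩
  have hz₀ : (algebraMap ℚ⟮z⟯ L) (z₀ ^ 2) = (algebraMap ℚ⟮z⟯ L) (-((q : ℚ) : ℚ⟮z⟯)) := by
    rw [map_pow, map_neg, map_ratCast]; exact hz
  have hz₀' : z₀ ^ 2 = -((q : ℚ) : ℚ⟮z⟯) := (algebraMap ℚ⟮z⟯ L).injective hz₀
  have hsq : (φ z₀) ^ 2 = -((q : ℚ) : ℂ) := by rw [← map_pow, hz₀', map_neg, map_ratCast]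
  have hfix : conj (φ z₀) = φ z₀ := by
    have := ComplexEmbedding.isReal_iff.1 hreal
    exact (RingHom.congr_fun this z₀ : _)
  obtain ⟨r, hr⟩ := Complex.conj_eq_iff_real.1 hfix
  rw [hr] at hsq
  have hr2 : (r ^ 2 : ℝ) = -(q : ℝ) := by exact_mod_cast hsq
  have hq' : (0 : ℝ) < q := by exact_mod_cast hq
  nlinarith [sq_nonneg r]

/-! ### §6. The obstruction: for odd `[L⁺:ℚ]`, the census inclusion forces an adapted CM type WITH small reflex -/

/-- A CM field has a non-zero purely imaginary element (`x = y - ȳ` for any `y ∉ L⁺`). [cite: Shimura1998, §18.2] -/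
theorem exists_complexConj_eq_neg : ∃ x : L, x ≠ 0 ∧ IsCMField.complexConj L x = -x := by
  have h1 := IsCMField.complexConj_ne_one (K := L)
  have : ∃ y : L, IsCMField.complexConj L y ≠ y := by
    by_contra h
    exact h1 (AlgEquiv.ext fun y => not_ne_iff.1 fun hy => h ⟨y, hy⟩)
  obtain ⟨y, hy⟩ := this
  refine ⟨y - IsCMField.complexConj L y, sub_ne_zero.2 (Ne.symm hy), ?_⟩
  rw [map_sub, IsCMField.complexConj_apply_apply, neg_sub]

/-- The number of infinite places of a CM field is `[L⁺ : ℚ]`. [cite: MilneCM2006, Ch. I §1 Def. 1.8] -/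
theorem card_infinitePlace_eq_finrank_maximalRealSubfield :
    Fintype.card (InfinitePlace L) = finrank ℚ ↥(maximalRealSubfield L) := by
  rw [← IsCMField.card_infinitePlace_eq_card_infinitePlace, InfinitePlace.card_eq_nrRealPlaces_add_nrComplexPlaces,
    IsTotallyReal.nrComplexPlaces_eq_zero, add_zero, ← IsTotallyReal.finrank]

/-- **THE OBSTRUCTION.**  Let `L` be a CM field with `d = [L⁺:ℚ]` ODD and `τ : L → ℂ`.  If the reflex composita of the `τ`-adapted
CM types meet inside `τ(L)` — the census inclusion `⨅_{Φ ∋ τ} E♯(Φ) ⊆ τ(L)` under which row I-6 ([Deligne1971TravauxShimura] Prop. 5.10)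
closes hDel's residual (`isCanonicalDescentAt_of_descentToIntersection_of_census`) — then SOME `τ`-adapted CM type has small reflex.
Proof: for `x̄ = -x ≠ 0` and an adapted `Φ₀`, `u = u_{Φ₀}(x) ∈ E∩ ⊆ τ(L)` (`prod_erase_mem_iInf_reflexField`), say `u = τ(w)`; then
`τ((wx)²) = (u·τ(x))² = (-1)^d N(x) = -N(x)` with `N(x) ∈ ℚ_{>0}` (`prod_erase_mul_sq_eq`, `norm_pos_of_cmType`), so `(wx)² = -N(x)` and
`ℚ(wx) ⊆ L` is an imaginary quadratic field (§5), whence an adapted type with small reflex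
(`Aux.exists_isAdapted_and_hasSmallReflex_of_quadraticSubfield`, [MilneCM2006] Prop. 1.18 (c)).
[cite: Liu2021, App. C Rem. C.15 (p. 113)] [cite: MilneCM2006, Ch. I §1 Prop. 1.18 (c)] [cite: Shimura1998, §8.3 Prop. 28 and §8.4 Example (1)] -/
theorem exists_isAdapted_and_hasSmallReflex_of_iInf_reflexField_le_range_of_odd (τ : L →+* ℂ)
    (hodd : Odd (finrank ℚ ↥(maximalRealSubfield L)))
    (hc : ((⨅ Φ : {Φ : CMType L // Aux.IsAdapted L Φ τ}, Aux.reflexField L Φ.1 τ : IntermediateField ℚ ℂ) : Set ℂ) ⊆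
      Set.range τ) :
    ∃ Φ : CMType L, Aux.IsAdapted L Φ τ ∧ Aux.HasSmallReflex L Φ τ := by
  classical
  obtain ⟨x, hx0, hx⟩ := exists_complexConj_eq_neg (L := L)
  obtain ⟨Φ₀, h₀⟩ := Aux.exists_isAdapted (L := L) τ
  obtain ⟨w, hw⟩ := hc (prod_erase_mem_iInf_reflexField τ h₀ hx)
  have hsq := prod_erase_mul_sq_eq Φ₀ h₀ hx
  rw [card_infinitePlace_eq_finrank_maximalRealSubfield, hodd.neg_one_pow, ← hw, ← map_mul, ← map_pow, neg_one_mul] at hsq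
  -- `(w x)² = -N(x)` in `L`
  set n : ℚ := Algebra.norm ℚ x with hn
  have hn0 : 0 < n := norm_pos_of_cmType Φ₀ hx0
  have hzL : (w * x) ^ 2 = -((n : ℚ) : L) := by
    apply τ.injective
    rw [hsq, map_neg, map_ratCast, eq_ratCast]
  -- the imaginary quadratic subfield `ℚ(w x) ⊆ L`
  haveI := isTotallyComplex_adjoin_of_sq_eq_neg hn0 hzL
  exact Aux.exists_isAdapted_and_hasSmallReflex_of_quadraticSubfield (finrank_adjoin_eq_two_of_sq_eq_neg hn0 hzL)
    (algebraMap ↥ℚ⟮w * x⟯ L) τ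

/-- **Corollary (the vacuity of «I-6 + census» against «no small reflex» for odd `[L⁺:ℚ]`).**  If `[L⁺:ℚ]` is odd and NO `τ`-adapted CM
type has small reflex (the hypothesis of the workfile's residual `NoSmallReflexBaseDescent`), then the census inclusion FAILS:
`⨅_{Φ ∋ τ} E♯(Φ) ⊄ τ(L)` — Deligne's descent to the intersection lands over a PROPER extension of `τ(L)`.
[cite: Liu2021, App. C Rem. C.15 (p. 113)] [cite: Deligne1971TravauxShimura, Prop. 5.10 p. 157] -/
theorem not_iInf_reflexField_le_range_of_odd_of_forall_not_hasSmallReflex (τ : L →+* ℂ)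
    (hodd : Odd (finrank ℚ ↥(maximalRealSubfield L)))
    (hno : ∀ Φ : CMType L, Aux.IsAdapted L Φ τ → ¬ Aux.HasSmallReflex L Φ τ) :
    ¬ (((⨅ Φ : {Φ : CMType L // Aux.IsAdapted L Φ τ}, Aux.reflexField L Φ.1 τ : IntermediateField ℚ ℂ) : Set ℂ) ⊆
        Set.range τ) := fun hc => by
  obtain ⟨Φ, hΦ, hs⟩ := exists_isAdapted_and_hasSmallReflex_of_iInf_reflexField_le_range_of_odd τ hodd hc
  exact hno Φ hΦ hs

end CM

end Summit.HodgeConjecture.CorCM.HypDel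

end
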